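import Mathlib
import HarnessLib
import Summits.HubbardSuperconductivity.HubbardSuperconductivity.Theorems.KLProgrammeKLRegimeEngineTowerChernoff

/-!
# Route `KLProgramme` — crux K3 ENGINE (stmt-HubbardSuperconductivity-20437 `KLRegimeEngineV17F2`), stub (b): the blocked-tower bookkeeping,
# part 7 — the READ-OUT at an arbitrary level (E1 lead r2d-p2 g5, memo E1-TOWER-BLOCKED §2 last paragraph)

The recursion (parts 2/4/5) bounds the increments BORN at the block boundaries `J_k`.  The public laws are read at EVERY level `j`
(`KernelNormsV4 … (K_n) n`, `KernelNormsWt4`/`LevelsUAt … (K_n) j`, `j ≤ n`): with `J_k ≤ j < J_{k+1}`, `𝒱_j = 𝒱_{J_k} + (𝒱_j − 𝒱_{J_k})`, so the public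
size at `j` is at most (measured size of `𝒱_{J_k}` at family `j`) + (born size of the ONE partial-block increment `J_k → j`).  Nothing here is fed
back into the recursion, so the per-leg-pair constants of this step (`c₂`, `4`, `2τψ`, and the partial block's `8^{j−J_k}` inside `σ, τ, ψ, Φ`) go
into the PUBLIC constant and need no blocking condition:

* `towerReadoutMeasured_le` — the measured profile at level `j` from the born law (jump ≥ 0 blocks, `towerMeasured_le_profile₀`):
  `μ m ≤ (c₁A/(1−g))·λ^{m−1}·(c₂Q)^m` for `4 ≤ m ≤ D` (degrees `2m ≥ 8`; six legs enter as the import `ι₃λ²`, however derived — uniform count,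
  split/correlated count (U7-(c1)), or `towerMeasured_three_le`);
* **`towerReadoutIncrement_le`** — the partial-block increment in every degree `2p ≥ 6` from the four-piece Chernoff data at the read-out
  profile `(A″, Q″) ≥ (c₁A/(1−g), c₂Q)`: `inc ≤ λ^{p−1}·(A″(4Q″)^p·x₁/(1−x₁) + e·ψ·(2τψQ″)^{p−1}·τY·y/(1−y))`,
  `Y = ι₁λ + ι₂/(2Q″) + ι₃/(4Q″²) + A″Q″/4`, `y = ΦτY < 1` — i.e. a geometric profile with per-leg-pair constant `max(4Q″, 2τψQ″)`: the public `CE`.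
At a boundary itself (`j = J_k`) the increment is absent and the first bullet is the read-out.  Pure real analysis; nothing about the model is asserted.
-/

noncomputable section

namespace Summit.HubbardSuperconductivity.HubbardSuperconductivity.Theorems.EngineV8

set_option linter.dupNamespace false -- summit = problem name (single-conjunct summit), D-0017

open Real Finset

/-- **The measured profile at a read-out level from the born law** (degrees `2m ≥ 8`): if the increments born at the boundaries `k' ≤ k` obey
`b k' m ≤ Aλ^{m−1}Q^m` (`3 ≤ m ≤ D`) and the size of `𝒱_{J_k}` measured at the read-out family is bounded by the jump-`≥ 0` re-measurement sum
`μ m ≤ Σ_{k'≤k} c₁c₂^m g^{(m−2)(k−k')} b k' m` for `4 ≤ m ≤ D`, then `μ m ≤ (c₁A/(1−g))·λ^{m−1}·(c₂Q)^m` there. -/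
theorem towerReadoutMeasured_le {D : ℕ} {b μ : ℕ → ℕ → ℝ} {A lam Q g c₁ c₂ : ℝ}
    (hA : 0 ≤ A) (hlam : 0 ≤ lam) (hQ : 0 ≤ Q) (hg0 : 0 ≤ g) (hg1 : g < 1) (hc₁ : 0 ≤ c₁) (hc₂ : 0 ≤ c₂)
    (hb0 : ∀ k m, 0 ≤ b k m) {k : ℕ}
    (hμ : ∀ m, 4 ≤ m → m ≤ D → μ k m ≤ ∑ k' ∈ range (k + 1), c₁ * c₂ ^ m * g ^ ((m - 2) * (k - k')) * b k' m)
    (hborn : ∀ k' ≤ k, ∀ m, 3 ≤ m → m ≤ D → b k' m ≤ A * lam ^ (m - 1) * Q ^ m)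
    {m : ℕ} (hm : 4 ≤ m) (hmD : m ≤ D) :
    μ k m ≤ c₁ * A / (1 - g) * lam ^ (m - 1) * (c₂ * Q) ^ m := by
  -- zero the degrees below eight and apply the jump-`≥ 0` re-measurement lemma
  set μ4 : ℕ → ℕ → ℝ := fun k m => if 4 ≤ m then μ k m else 0 with hμ4
  have hμ4hyp : ∀ m, 3 ≤ m → m ≤ D → μ4 k m ≤ ∑ k' ∈ range (k + 1), c₁ * c₂ ^ m * g ^ ((m - 2) * (k - k')) * b k' m := by
    intro m _ hmD
    rw [hμ4]; dsimp only
    split_ifs with h4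
    · exact hμ m h4 hmD
    · exact sum_nonneg fun k' _ => by have := hb0 k' m; positivity
  have h := towerMeasured_le_profile₀ (D := D) (μ := μ4) hA hlam hQ hg0 hg1 hc₁ hc₂ hb0 hμ4hyp hborn (by omega) hmD
  rw [hμ4] at h; dsimp only at h; rw [if_pos hm] at h
  exact h

/-- **The partial-block increment at a read-out level, every degree `2p ≥ 6`.**  Inputs = the sizes of `𝒱_{J_k}` measured at the read-out
family: `0 ≤ μ`, imports `μ 1 ≤ ι₁λ`, `μ 2 ≤ ι₂λ`, six legs `μ 3 ≤ ι₃λ²` (however derived), and the profile `μ m ≤ A″λ^{m−1}Q″^m` for `4 ≤ m ≤ D`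
(`towerReadoutMeasured_le` with `A″ ≥ c₁A/(1−g)`, `Q″ ≥ c₂Q`); the suppliers' step hypothesis for the increment with the partial block's
constants `(σ, Φ, ψ, τ)`; smallness `x₁ = 4σλQ″ < 1`, `2λτQ″ ≤ 1`, `x₃ = eτλQ″ < 1`, `y = Φτ(ι₁λ + ι₂/(2Q″) + ι₃/(4Q″²) + A″Q″/4) < 1`,
`θ̄ < 1` (four-piece `V̄`).  Then for `3 ≤ p`:
`inc ≤ λ^{p−1}·(A″(4Q″)^p·x₁/(1−x₁) + e·ψ·(2τψQ″)^{p−1}·τ(ι₁λ + ι₂/(2Q″) + ι₃/(4Q″²) + A″Q″/4)·y/(1−y))` — no blocking condition (nothing is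
fed back); the per-leg-pair constants `4Q″`, `2τψQ″` are the public law's. -/
theorem towerReadoutIncrement_le {D : ℕ} {μ : ℕ → ℝ} {inc σ Φ ψ τ lam A'' Q'' ι₁ ι₂ ι₃ : ℝ}
    (hσ : 0 ≤ σ) (hΦ : 0 ≤ Φ) (hψ : 0 ≤ ψ) (hτ : 0 < τ) (hlam : 0 < lam) (hA'' : 0 ≤ A'') (hQ'' : 0 < Q'')
    (hμ0 : ∀ m, 0 ≤ μ m) (hι₁ : μ 1 ≤ ι₁ * lam) (hι₂ : μ 2 ≤ ι₂ * lam) (hι₃ : μ 3 ≤ ι₃ * lam ^ 2)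
    (hprof : ∀ m, 4 ≤ m → m ≤ D → μ m ≤ A'' * lam ^ (m - 1) * Q'' ^ m)
    (hx₁ : 4 * σ * lam * Q'' < 1) (hx₂ : 2 * lam * τ * Q'' ≤ 1) (hx₃ : exp 1 * τ * lam * Q'' < 1)
    (hy : Φ * (τ * (ι₁ * lam + ι₂ / (2 * Q'') + ι₃ / (4 * Q'' ^ 2) + A'' * Q'' / 4)) < 1)
    (hθ : Φ * (exp 1 * τ * (ι₁ * lam) + (exp 1 * τ) ^ 2 * (ι₂ * lam) + (exp 1 * τ) ^ 3 * (ι₃ * lam ^ 2) +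
      A'' * (exp 1 * τ * Q'') * ((exp 1 * τ * lam * Q'') ^ 3 / (1 - exp 1 * τ * lam * Q''))) < 1)
    {p : ℕ} (hp : 3 ≤ p)
    (hstep : ∀ N : ℕ, 2 ≤ N → Φ * towerV D τ μ < 1 →
      inc ≤ towerFO D σ μ p + ∑ n ∈ Icc 2 N, exp 1 * Φ ^ (n - 1) * ψ ^ p * towerS D τ μ n p +
        ψ ^ p * exp 1 * towerV D τ μ * (Φ * towerV D τ μ) ^ N / (1 - Φ * towerV D τ μ)) :
    inc ≤ lam ^ (p - 1) * (A'' * (4 * Q'') ^ p * (4 * σ * lam * Q'' / (1 - 4 * σ * lam * Q'')) +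
      exp 1 * ψ * (2 * τ * ψ * Q'') ^ (p - 1) * (τ * (ι₁ * lam + ι₂ / (2 * Q'') + ι₃ / (4 * Q'' ^ 2) + A'' * Q'' / 4)) *
        (Φ * (τ * (ι₁ * lam + ι₂ / (2 * Q'') + ι₃ / (4 * Q'' ^ 2) + A'' * Q'' / 4)) /
          (1 - Φ * (τ * (ι₁ * lam + ι₂ / (2 * Q'') + ι₃ / (4 * Q'' ^ 2) + A'' * Q'' / 4))))) := by
  have hw : 1 ≤ (2 * τ * Q'' * lam)⁻¹ := (one_le_inv₀ (by positivity)).2 (by linarith)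
  set Y := ι₁ * lam + ι₂ / (2 * Q'') + ι₃ / (4 * Q'' ^ 2) + A'' * Q'' / 4 with hY
  have hG := sum_fourPiece_le (D := D) hτ hlam hQ'' hA'' hμ0 hι₁ hι₂ hι₃ hprof
  have hVb := towerV_le_fourPiece hτ.le hlam.le hQ''.le hA'' hμ0 hι₁ hι₂ hι₃ hprof hx₃
  have hFO := towerFO_le_of_four_le hσ hA'' hlam.le hQ''.le hμ0 hprof hx₁ hp (D := D)
  have hT2 := towerStep_le_of_chernoff (D := D) hΦ hψ hτ.le hμ0 hw hFO hG hVb hy hθ hstep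
  refine hT2.trans (le_of_eq ?_)
  have hinv : (((2 * τ * Q'' * lam)⁻¹) ^ (p - 1))⁻¹ = (2 * τ * Q'' * lam) ^ (p - 1) := by rw [inv_pow, inv_inv]
  rw [hinv]
  obtain ⟨q, rfl⟩ : ∃ q, p = q + 1 := ⟨p - 1, by omega⟩
  simp only [Nat.add_sub_cancel, pow_succ, mul_pow]
  ring

/-- **The read-out, assembled**: at a level whose last boundary is `k`, with `𝒱_j`'s degree-`2p` public size dominated by
(measured size of `𝒱_{J_k}`) + (partial-block increment), `3 ≤ p ≤ D`, `4 ≤ p` case through `towerReadoutMeasured_le` and the six-leg case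
through the import `ι₃λ²`:  `pub ≤ λ^{p−1}·(M_p + A″(4Q″)^p·x₁/(1−x₁) + e·ψ·(2τψQ″)^{p−1}·τY·y/(1−y))` with `M_p = A″Q″^p` (`p ≥ 4`) or
`M_3 = ι₃` — a geometric profile in `p`: the public per-leg-pair constant is `max(Q″, 4Q″, 2τψQ″)` times `λ = B·Klam·|U|`. -/
theorem towerReadout_le {D : ℕ} {μ : ℕ → ℝ} {pub inc σ Φ ψ τ lam A'' Q'' ι₁ ι₂ ι₃ : ℝ}
    (hσ : 0 ≤ σ) (hΦ : 0 ≤ Φ) (hψ : 0 ≤ ψ) (hτ : 0 < τ) (hlam : 0 < lam) (hA'' : 0 ≤ A'') (hQ'' : 0 < Q'')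
    (hμ0 : ∀ m, 0 ≤ μ m) (hι₁ : μ 1 ≤ ι₁ * lam) (hι₂ : μ 2 ≤ ι₂ * lam) (hι₃ : μ 3 ≤ ι₃ * lam ^ 2)
    (hprof : ∀ m, 4 ≤ m → m ≤ D → μ m ≤ A'' * lam ^ (m - 1) * Q'' ^ m)
    (hx₁ : 4 * σ * lam * Q'' < 1) (hx₂ : 2 * lam * τ * Q'' ≤ 1) (hx₃ : exp 1 * τ * lam * Q'' < 1)
    (hy : Φ * (τ * (ι₁ * lam + ι₂ / (2 * Q'') + ι₃ / (4 * Q'' ^ 2) + A'' * Q'' / 4)) < 1)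
    (hθ : Φ * (exp 1 * τ * (ι₁ * lam) + (exp 1 * τ) ^ 2 * (ι₂ * lam) + (exp 1 * τ) ^ 3 * (ι₃ * lam ^ 2) +
      A'' * (exp 1 * τ * Q'') * ((exp 1 * τ * lam * Q'') ^ 3 / (1 - exp 1 * τ * lam * Q''))) < 1)
    {p : ℕ} (hp : 3 ≤ p) (hpD : p ≤ D) (hpub : pub ≤ μ p + inc)
    (hstep : ∀ N : ℕ, 2 ≤ N → Φ * towerV D τ μ < 1 →
      inc ≤ towerFO D σ μ p + ∑ n ∈ Icc 2 N, exp 1 * Φ ^ (n - 1) * ψ ^ p * towerS D τ μ n p +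
        ψ ^ p * exp 1 * towerV D τ μ * (Φ * towerV D τ μ) ^ N / (1 - Φ * towerV D τ μ)) :
    pub ≤ lam ^ (p - 1) * ((if p = 3 then ι₃ else A'' * Q'' ^ p) + A'' * (4 * Q'') ^ p * (4 * σ * lam * Q'' / (1 - 4 * σ * lam * Q'')) +
      exp 1 * ψ * (2 * τ * ψ * Q'') ^ (p - 1) * (τ * (ι₁ * lam + ι₂ / (2 * Q'') + ι₃ / (4 * Q'' ^ 2) + A'' * Q'' / 4)) *
        (Φ * (τ * (ι₁ * lam + ι₂ / (2 * Q'') + ι₃ / (4 * Q'' ^ 2) + A'' * Q'' / 4)) /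
          (1 - Φ * (τ * (ι₁ * lam + ι₂ / (2 * Q'') + ι₃ / (4 * Q'' ^ 2) + A'' * Q'' / 4))))) := by
  have hinc := towerReadoutIncrement_le (D := D) hσ hΦ hψ hτ hlam hA'' hQ'' hμ0 hι₁ hι₂ hι₃ hprof hx₁ hx₂ hx₃ hy hθ hp hstep
  have hμp : μ p ≤ lam ^ (p - 1) * (if p = 3 then ι₃ else A'' * Q'' ^ p) := by
    split_ifs with h3
    · subst h3; simpa [mul_comm] using hι₃
    · have h4 : 4 ≤ p := by omega
      calc μ p ≤ A'' * lam ^ (p - 1) * Q'' ^ p := hprof p h4 hpD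
        _ = lam ^ (p - 1) * (A'' * Q'' ^ p) := by ring
  refine hpub.trans ((add_le_add hμp hinc).trans (le_of_eq ?_))
  ring

end Summit.HubbardSuperconductivity.HubbardSuperconductivity.Theorems.EngineV8

end
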